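import Summits.CriticalPhenomena.Ising3DConformalLimit.Theses.HyperoctahedralRP
import Summits.CriticalPhenomena.Ising3DConformalLimit.Theorems.HyperoctahedralRPExistsScaleCovariantLimitDoublingOfDyadicPairRatio
import Summits.CriticalPhenomena.Ising3DConformalLimit.Theorems.HyperoctahedralRPExistsScaleCovariantLimitBlockMomentBounded
import Summits.CriticalPhenomena.Ising3DConformalLimit.Theorems.HyperoctahedralRPExistsScaleCovariantLimitBlockCovAlgebra
import Summits.CriticalPhenomena.Ising3DConformalLimit.Theorems.HyperoctahedralRPExistsScaleCovariantLimitBlockCovTwoPointBounds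
import Summits.CriticalPhenomena.Ising3DConformalLimit.Theorems.HyperoctahedralRPExistsScaleCovariantLimitTwoPointScalingOfLattice
import Summits.CriticalPhenomena.Ising3DConformalLimit.Theorems.HyperoctahedralRPExistsScaleCovariantLimitIntMeshOfBlockLimits
import HarnessLib

/-!
# Convergence of the critical block moments gives the scaling limit
(line `monotone-blocking-port` of the crux `ExistsScaleCovariantLimit`, item stmt-CriticalPhenomena-1981, route
`HyperoctahedralRP`; lead prover-line-stmt-CriticalPhenomena-1981-a1-0, 2026-08-16; registered glue sub-goal
`ExistsScaleCovariantLimit_of_blockLimits`)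

The UNCONDITIONAL output of the line, assembled from its five landed stubs S3 `stub_blockMomentBounded` (Griffiths +
Newman), S4a `stub_blockCovAlgebra` (sub-cube decomposition), S4b `stub_blockCovTwoPointBounds` (Messager–Miracle-Solé
sandwich + top-heavy scales), S4c `stub_twoPointScaling_of_lattice` (regular variation by squeezing along multiples), S5
`stub_intMesh_of_blockLimits` (de-smearing), and the landed tails D6 `stub_twoPointDoubling_of_dyadicPairRatio`
(p123864), `ItemMaps.uniformRegularity_of_doubling` / `orbitPrecompact_of_doubling` (p120504),
`TwoHierarchies.crux_iff_intMeshConvergence` (p123864). Write `V(L) = Σ_{x,y ∈ cube L} ⟨σ_xσ_y⟩_{β_c}`,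
`R_n(L;k⃗) = Σ_{xᵢ ∈ cube L} ⟨∏ᵢ σ_{xᵢ + Lkᵢ}⟩_{β_c} / V(L)^{n/2}` (`critBlockMoment`), `g(m) = ⟨σ₀σ_{me₀}⟩_{β_c}`.

* `twoPointScaling_of_blockTwoLimits_holds` — **if every block two-point ratio `R₂(L; k₀,k₁)`, `k₀ ≠ k₁`, converges as
  `L → ∞`, then `m⁶ g(m)/V(m) → Φ > 0` and `g(jm)/g(m) → r_j > 0` for every `j ≥ 1`** (the axial critical two-point
  function is regularly varying along integer dilations: `η(3)` exists in that sense).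
* `twoPointDoubling_of_blockTwoLimits`, `uniformRegularity_of_blockTwoLimits`, `orbitPrecompact_of_blockTwoLimits` —
  **the same hypothesis gives item 6150 `TwoPointDoubling`, item 4658 `UniformRegularity`, item 5955 `OrbitPrecompact`**:
  the whole compactness half of the crux.
* `intMeshConvergence_of_blockLimits`, **`ExistsScaleCovariantLimit_of_blockLimits` — if every block moment `R_n(L;k⃗)`
  of order `n ≥ 2` at pairwise distinct block positions converges as `L → ∞`, the crux holds**: the scale-covariant
  continuum limit of the critical `ℤ³` Ising spin correlations exists. No monotonicity, no renormalisation constant, no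
  continuum object in the hypothesis — a lattice characterisation of the open existence problem by SMEARED data.
* `blockLimits_of_monotoneBlocking`, `ExistsScaleCovariantLimit_of_monotoneBlocking` — conjecture BM (the two research
  stubs `Sig.stub_monotoneBlockingTwo`, `Sig.stub_monotoneBlockingHigher`, taken BY NAME as hypotheses) gives `BlockLimits`
  (monotone + bounded ⇒ convergent, S3 landed) and hence the crux; `twoPointDoubling_of_monotoneBlockingTwo` — BM₂ alone
  gives item 6150 (and 4658, 5955, two-point scaling).

References: A. Messager, S. Miracle-Solé, J. Stat. Phys. 17 (1977); C. M. Newman, Z. Wahrsch. 33 (1975); M. Aizenman,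
H. Duminil-Copin, Ann. Math. 194 (2021), arXiv:1912.07973 Remark 5.10; H. Duminil-Copin, ICM 2022 §8.4 (the existence
problem). No definitions, no named-fact hypotheses other than the two conjecture statements where indicated, no `sorry`.
-/

noncomputable section

namespace Summit.CriticalPhenomena.Ising3DConformalLimit.Cruxes.ExistsScaleCovariantLimit.MonotoneBlockingPort

open Literature.Probability.LatticeModels Filter Set
open scoped Topology BigOperators
open Summit.CriticalPhenomena.Ising3DConformalLimit.MoebiusLimitExistsOnlyInteraction (rhoPin)
open Summit.CriticalPhenomena.Ising3DConformalLimit.Theses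
open Summit.CriticalPhenomena.Ising3DConformalLimit.Cruxes.ExistsScaleCovariantLimit.TwoHierarchies
open Summit.CriticalPhenomena.Ising3DConformalLimit.MonotoneRGZoomGlue (tendsto_of_eventually_monotone_of_bounded)

/-! ## The `n = 2` output: two-point scaling and the compactness items -/

/-- **Block two-point limits ⟹ two-point scaling, unconditionally** (S4c applied to the landed lattice facts S4a, S4b): if
every block two-point ratio at distinct block positions converges as `L → ∞` then `m⁶ g(m)/V(m) → Φ > 0` and
`g(jm)/g(m) → r_j > 0` for every `j ≥ 1`. [folklore] -/
theorem twoPointScaling_of_blockTwoLimits_holds : Sig.stub_twoPointScaling_of_blockTwoLimits :=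
  stub_twoPointScaling_of_lattice stub_blockCovAlgebra stub_blockCovTwoPointBounds

/-- All-order block limits contain the block two-point limits (`n = 2`). [folklore] -/
theorem blockTwoLimits_of_blockLimits (h : BlockLimits) : BlockTwoLimits :=
  fun k hk => h 2 le_rfl k hk

/-- Two-point scaling (ii) at `j = 2` is convergence of the pinned pair zoom at `(0, 2e₀)` along the dyadic meshes `2^{-k}`:
that zoom is `g(2^{k+1})/g(2^k)` exactly (`pz_two_geomPair`). [folklore] -/
theorem dyadicPairRatio_of_twoPointScaling (hscal : TwoPointScaling) :
    ∃ L : ℝ, Tendsto (fun k : ℕ => rescaledCorrelator (criticalCorr 3) rhoPin 2 (((2:ℝ) ^ k)⁻¹)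
        (![0, EuclideanSpace.single 0 (2:ℝ)] : Fin 2 → EuclideanSpace ℝ (Fin 3))) atTop (𝓝 L) := by
  obtain ⟨r, -, hr⟩ := hscal.2 2 (by norm_num)
  refine ⟨r, ?_⟩
  have hpow : Tendsto (fun k : ℕ => 2 ^ k) atTop atTop := tendsto_pow_atTop_atTop_of_one_lt one_lt_two
  refine (hr.comp hpow).congr fun k => ?_
  have e := pz_two_geomPair 2 1 k
  simp only [Nat.cast_ofNat, pow_one] at e
  rw [Function.comp_apply, e, pow_add, pow_one]

/-- **Block two-point limits ⟹ item 6150 `TwoPointDoubling`** (`κ g(n) ≤ g(2n)` for all `n ≥ 1`), by D6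
`stub_twoPointDoubling_of_dyadicPairRatio`. [cite: AizenmanDuminilCopinAnnals2021, arXiv:1912.07973 Remark 5.10] -/
theorem twoPointDoubling_of_blockTwoLimits (h : BlockTwoLimits) : MirrorHoelderCompactness.TwoPointDoubling :=
  stub_twoPointDoubling_of_dyadicPairRatio (dyadicPairRatio_of_twoPointScaling (twoPointScaling_of_blockTwoLimits_holds h))

/-- **Block two-point limits ⟹ item 4658 `UniformRegularity`** (uniform bounds, asymptotic equicontinuity and positivity of
the pinned zoom on compacts), by `ItemMaps.uniformRegularity_of_doubling`. [folklore] -/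
theorem uniformRegularity_of_blockTwoLimits (h : BlockTwoLimits) : MonotoneRG.UniformRegularity :=
  ItemMaps.uniformRegularity_of_doubling (twoPointDoubling_of_blockTwoLimits h)

/-- **Block two-point limits ⟹ item 5955 `OrbitPrecompact`** (precompactness of the pinned zoom orbit at all orders), by
`ItemMaps.orbitPrecompact_of_doubling`. [folklore] -/
theorem orbitPrecompact_of_blockTwoLimits (h : BlockTwoLimits) : MonotoneRG.OrbitPrecompact :=
  ItemMaps.orbitPrecompact_of_doubling (twoPointDoubling_of_blockTwoLimits h)

/-! ## All orders: block limits give the crux -/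

/-- **Block limits ⟹ integer-mesh convergence of the pinned zoom** (S5 de-smearing, with its two auxiliary hypotheses —
two-point scaling and equicontinuity — now discharged from the `n = 2` part of the same hypothesis). [folklore] -/
theorem intMeshConvergence_of_blockLimits (h : BlockLimits) : IntMeshConvergence :=
  stub_intMesh_of_blockLimits h (twoPointScaling_of_blockTwoLimits_holds (blockTwoLimits_of_blockLimits h))
    (uniformRegularity_of_blockTwoLimits (blockTwoLimits_of_blockLimits h))

/-- **BLOCK LIMITS GIVE THE CRUX.** If every normalised block moment `R_n(L; k⃗)` (`n ≥ 2`, pairwise distinct block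
positions `k⃗`) of the critical nearest-neighbour Ising model on `ℤ³` converges as the block side `L → ∞`, then the
scale-covariant continuum scaling limit of the critical spin correlations exists
(`HyperoctahedralRP.ExistsScaleCovariantLimit`, via the landed `TwoHierarchies.crux_iff_intMeshConvergence`).
[cite: DuminilCopinICM2022, §8.4 p. 29] -/
theorem ExistsScaleCovariantLimit_of_blockLimits :
    BlockLimits → Summit.CriticalPhenomena.Ising3DConformalLimit.Theses.HyperoctahedralRP.ExistsScaleCovariantLimit :=
  fun h => crux_iff_intMeshConvergence.2 (intMeshConvergence_of_blockLimits h)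

/-! ## Conjecture BM (the two research stubs, taken by name) gives block limits, hence the crux -/

/-- **BM ⟹ block limits**: eventual monotonicity of the block moments at orders `2` (`Sig.stub_monotoneBlockingTwo`) and
`≥ 3` (`Sig.stub_monotoneBlockingHigher`) plus the landed uniform bounds S3 give convergence of every block moment of order
`≥ 2` along the full integer filter (monotone + bounded ⇒ convergent). CONDITIONAL on conjecture BM. [folklore] -/
theorem blockLimits_of_monotoneBlocking (h1 : Sig.stub_monotoneBlockingTwo) (h2 : Sig.stub_monotoneBlockingHigher) :
    BlockLimits := by
  intro n hn k hk
  obtain ⟨C, hC⟩ := stub_blockMomentBounded n k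
  have hbd : ∀ᶠ L in atTop, |critBlockMoment n L k| ≤ C :=
    (eventually_ge_atTop 1).mono fun L hL => hC L hL
  rcases Nat.lt_or_ge 2 n with hlt | hle
  · obtain ⟨L₀, hmono⟩ := h2 n hlt k hk
    exact tendsto_of_eventually_monotone_of_bounded hmono hbd
  · have hn2 : n = 2 := le_antisymm hle hn
    subst hn2
    obtain ⟨L₀, hmono⟩ := h1 k hk
    exact tendsto_of_eventually_monotone_of_bounded hmono hbd

/-- **BM₂ ⟹ block two-point limits** (conditional on `Sig.stub_monotoneBlockingTwo` only). [folklore] -/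
theorem blockTwoLimits_of_monotoneBlockingTwo (h1 : Sig.stub_monotoneBlockingTwo) : BlockTwoLimits := by
  intro k hk
  obtain ⟨C, hC⟩ := stub_blockMomentBounded 2 k
  obtain ⟨L₀, hmono⟩ := h1 k hk
  exact tendsto_of_eventually_monotone_of_bounded hmono ((eventually_ge_atTop 1).mono fun L hL => hC L hL)

/-- **BM₂ ALONE ⟹ item 6150 `TwoPointDoubling`** (hence items 4658, 5955 and two-point scaling): the `n = 2` milestone
of the line, conditional on conjecture BM₂ only. [cite: AizenmanDuminilCopinAnnals2021, arXiv:1912.07973 Remark 5.10] -/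
theorem twoPointDoubling_of_monotoneBlockingTwo (h1 : Sig.stub_monotoneBlockingTwo) :
    MirrorHoelderCompactness.TwoPointDoubling :=
  twoPointDoubling_of_blockTwoLimits (blockTwoLimits_of_monotoneBlockingTwo h1)

/-- **BM ⟹ THE CRUX** (conditional on the two conjecture statements, everything else discharged). [cite: DuminilCopinICM2022, §8.4 p. 29] -/
theorem ExistsScaleCovariantLimit_of_monotoneBlocking (h1 : Sig.stub_monotoneBlockingTwo)
    (h2 : Sig.stub_monotoneBlockingHigher) :
    Summit.CriticalPhenomena.Ising3DConformalLimit.Theses.HyperoctahedralRP.ExistsScaleCovariantLimit :=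
  ExistsScaleCovariantLimit_of_blockLimits (blockLimits_of_monotoneBlocking h1 h2)

end Summit.CriticalPhenomena.Ising3DConformalLimit.Cruxes.ExistsScaleCovariantLimit.MonotoneBlockingPort

end
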